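/-
Copyright (c) 2026 the pub-hodgecm-mathlib formalisation cell (harness21).  Prover seat hodgecm-mathlib-K2E4-p11 (g4), Track B ∕ K2-LIT, h413 =
`stmt-HodgeConjecture-24833`, line `K2_E1_TraceFormulaBeta`, campaign «EIS-RANK-ONE», rung R6h ∕ [D5]₃ E-LAYER, deal (E-b) of K2E1-plan (g4) 2026-09-04T07:22:26Z:
THE QUADRATIC SYMBOL `q(x) = 1 + ½‖x‖²` ON A REAL INNER-PRODUCT SPACE AND ITS COMPLEX POWERS `q^{−w}`, `q^{1−2z}` — derivative bounds UNIFORM on `‖w‖ ≤ R`.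
-/
import Summits.HodgeConjecture.HodgeConjecture.Theorems.K2E1SymbolFaaDiBruno   -- ★ (E-a) p858171 (K2E1-p08 (g5)): `norm_iteratedFDeriv_cpow_neg_le_of_symbol`, `contDiffOn_ofReal_cpow`
import HarnessLib

/-!
# h413 ∕ Track B «K2-LIT», «EIS-RANK-ONE» [D5]₃ (E-b) — `K2E1QuadraticNormPowSymbol`: `‖Dⁿ[(1 + ½‖x‖²)^{−w}](x)‖ ≤ C(n,R)·(1 + ½‖x‖²)^{−Re w}` for all `‖w‖ ≤ R`,
# on any real inner-product space (the archimedean factor of the big-cell height of `U(2,1)` at a complex place)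

Cell `pub/hodgecm-mathlib`, crux H413 = `stmt-HodgeConjecture-24833`, route `HCCMUnconditional`; dealer K2E1-plan (g4), deal (E-b) 07:22:26Z, REPORT-FIRST 07:45Z («=» 07:45:20Z).
THEOREMS ONLY (no `def`, no `instance`, no `notation`, no named-fact hypothesis, no `sorry`); lane `--kind proof --supports stmt-HodgeConjecture-24833 --as helper` (count-neutral).
Pure calculus over Mathlib + ★ (E-a) (a librarian may re-home §1–§2 under `Literature/Analysis/Calculus`).
WHY.  Along the big-cell Heisenberg line the height of `U(2,1)_{L∕L⁺}` is `H = (∏_{w∣∞} ((1+½‖X_w‖²)² + (wδ)² s_w²) · h_f)⁻¹` (★ (a2)₃); after the idele scaling of ★ (E-c)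
`K2E1CentreAverageScalingU3` the centre average of the spherical section is `const · ∏_w (1 + ½‖X_w‖²)^{1−2z}` as a function of the archimedean shift `X_∞ = (X_w)_w ∈ ∏_w ℂ`, and the
E-layer binder `hφarchZ` of ★ p858259 asks for `C^m` bounds of it dominated by `∏_w (1+½‖X_w‖²)^{1−2Re z}`, ONE constant for all `‖z‖ ≤ R`.  This file is the one-place estimate.
* §1 the squared norm `g(x) = ‖x‖²` on a real inner-product space `F`: `‖D¹g(x)‖ ≤ 2‖x‖`, `‖D²g(x)‖ ≤ 2`, `Dⁱg = 0` (`i ≥ 3`) (Mathlib `fderiv_norm_sq_apply`: `Dg = 2·innerSL`, a continuous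
  LINEAR map, whose derivative is constant).
* §2 the symbol `q = 1 + ½g ≥ 1`: `C^∞`, `‖Dⁱq(x)‖ ≤ 1·q(x)` for `i ≥ 1` (`‖x‖ ≤ 1 + ½‖x‖²`).
* §3 **`exists_norm_iteratedFDeriv_quad_cpow_neg_le_uniform (R) (n)`**: `∃ C ≥ 0, ∀ ‖w‖ ≤ R, ∀ x, ‖Dⁿ[q^{−w}](x)‖ ≤ C·q(x)^{−Re w}` (★ (E-a) with `K = 1`, its constant
  `Σ_c ∏_{l<|c|}(‖w‖+l)` bounded at `R`), `contDiff_quad_cpow_neg`, and the `1 − 2z` editions **`exists_norm_iteratedFDeriv_quad_cpow_one_sub_two_mul_le_uniform (R) (n)`** ∕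
  `contDiff_quad_cpow_one_sub_two_mul` consumed by (E-d) `K2E1HeightLineArchSmoothU3E` (`w = 2z − 1`, `‖w‖ ≤ 2R + 1`).
HONEST LABEL.  Count-neutral helper; proves no printed statement; HC_CM is proved only modulo the 7 printed citations (2 remaining named inputs: hLiu418 =
`stmt-HodgeConjecture-24832`, h413 = `stmt-HodgeConjecture-24833`) until rung 0 closes.

## References
* [HormanderALPDO1] L. Hörmander, *The Analysis of Linear Partial Differential Operators I* (1983), §7.1 (symbols, products and powers of symbols).
* [MoeglinWaldspurger1995] C. Mœglin, J.-L. Waldspurger, *Spectral decomposition and Eisenstein series* (1995), I.2.10–I.2.12.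
-/

set_option autoImplicit false
set_option linter.dupNamespace false  -- the mandated namespace repeats the summit's segment (`HodgeConjecture.HodgeConjecture`)

noncomputable section

open Set
open Summit.HodgeConjecture.HodgeConjecture.Cruxes.H413.K2E1SymbolFaaDiBruno (norm_iteratedFDeriv_cpow_neg_le_of_symbol contDiffOn_ofReal_cpow)
open scoped ContDiff

namespace Summit.HodgeConjecture.HodgeConjecture.Cruxes.H413.K2E1QuadraticNormPowSymbol

variable {F : Type*} [NormedAddCommGroup F] [InnerProductSpace ℝ F]

/-! ## §1 The squared norm on a real inner-product space: `‖D¹‖ ≤ 2‖x‖`, `‖D²‖ ≤ 2`, `Dⁱ = 0` (`i ≥ 3`) -/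

section NormSq

/-- `‖innerSL ℝ‖ ≤ 1` (Cauchy–Schwarz: `‖⟨x, ·⟩‖ = ‖x‖`). [folklore] -/
theorem norm_innerSL_real_le_one : ‖(innerSL ℝ : F →L[ℝ] F →L[ℝ] ℝ)‖ ≤ 1 :=
  ContinuousLinearMap.opNorm_le_bound _ zero_le_one fun x => by rw [innerSL_apply_norm, one_mul]

/-- **`D(‖·‖²) = innerSL + innerSL`**, a continuous LINEAR map of the base point (Mathlib `fderiv_norm_sq_apply`). [folklore] -/
theorem fderiv_norm_sq_eq_coe : fderiv ℝ (fun x : F => ‖x‖ ^ 2) = ⇑((innerSL ℝ : F →L[ℝ] F →L[ℝ] ℝ) + (innerSL ℝ : F →L[ℝ] F →L[ℝ] ℝ)) := by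
  funext x
  rw [fderiv_norm_sq_apply, two_smul, add_apply]

/-- The derivative of the linear map `innerSL + innerSL` is constant. [folklore] -/
theorem fderiv_coe_innerSL_add : fderiv ℝ (⇑((innerSL ℝ : F →L[ℝ] F →L[ℝ] ℝ) + (innerSL ℝ : F →L[ℝ] F →L[ℝ] ℝ))) =
    fun _ => ((innerSL ℝ : F →L[ℝ] F →L[ℝ] ℝ) + (innerSL ℝ : F →L[ℝ] F →L[ℝ] ℝ)) := by
  funext x
  exact ((innerSL ℝ : F →L[ℝ] F →L[ℝ] ℝ) + (innerSL ℝ : F →L[ℝ] F →L[ℝ] ℝ)).fderiv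

/-- **`‖D¹(‖·‖²)(x)‖ ≤ 2‖x‖`**. [folklore] -/
theorem norm_iteratedFDeriv_one_norm_sq_le (x : F) : ‖iteratedFDeriv ℝ 1 (fun x : F => ‖x‖ ^ 2) x‖ ≤ 2 * ‖x‖ := by
  rw [norm_iteratedFDeriv_one, fderiv_norm_sq_apply, two_smul]
  calc ‖innerSL ℝ x + innerSL ℝ x‖ ≤ ‖innerSL ℝ x‖ + ‖innerSL ℝ x‖ := norm_add_le _ _
    _ = 2 * ‖x‖ := by rw [innerSL_apply_norm]; ring

/-- **`‖D²(‖·‖²)(x)‖ ≤ 2`**. [folklore] -/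
theorem norm_iteratedFDeriv_two_norm_sq_le (x : F) : ‖iteratedFDeriv ℝ 2 (fun x : F => ‖x‖ ^ 2) x‖ ≤ 2 := by
  rw [← norm_iteratedFDeriv_fderiv, fderiv_norm_sq_eq_coe, ← norm_iteratedFDeriv_fderiv, fderiv_coe_innerSL_add, norm_iteratedFDeriv_zero]
  calc ‖(innerSL ℝ : F →L[ℝ] F →L[ℝ] ℝ) + (innerSL ℝ : F →L[ℝ] F →L[ℝ] ℝ)‖
      ≤ ‖(innerSL ℝ : F →L[ℝ] F →L[ℝ] ℝ)‖ + ‖(innerSL ℝ : F →L[ℝ] F →L[ℝ] ℝ)‖ := norm_add_le (innerSL ℝ (E := F)) (innerSL ℝ (E := F))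
    _ ≤ 1 + 1 := add_le_add norm_innerSL_real_le_one norm_innerSL_real_le_one
    _ = 2 := by norm_num

/-- **`Dⁱ(‖·‖²) = 0` for `i ≥ 3`**. [folklore] -/
theorem iteratedFDeriv_norm_sq_eq_zero_of_three_le {i : ℕ} (hi : 3 ≤ i) (x : F) : iteratedFDeriv ℝ i (fun x : F => ‖x‖ ^ 2) x = 0 := by
  obtain ⟨n, rfl⟩ : ∃ n, i = n + 1 + 1 + 1 := ⟨i - 3, by omega⟩
  rw [← norm_eq_zero, ← norm_iteratedFDeriv_fderiv, fderiv_norm_sq_eq_coe, ← norm_iteratedFDeriv_fderiv, fderiv_coe_innerSL_add,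
    iteratedFDeriv_const_of_ne (Nat.succ_ne_zero n), Pi.zero_apply, norm_zero]

end NormSq

/-! ## §2 The symbol `q(x) = 1 + ½‖x‖²` -/

section Quad

omit [InnerProductSpace ℝ F] in
/-- `1 ≤ 1 + ½‖x‖²`. [folklore] -/
theorem one_le_quad (x : F) : (1 : ℝ) ≤ 1 + ‖x‖ ^ 2 / 2 := le_add_of_nonneg_right (by positivity)

omit [InnerProductSpace ℝ F] in
/-- `0 < 1 + ½‖x‖²`. [folklore] -/
theorem quad_pos (x : F) : (0 : ℝ) < 1 + ‖x‖ ^ 2 / 2 := by positivity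

/-- `q` is smooth (Mathlib `contDiff_norm_sq`). [folklore] -/
theorem contDiff_quad {n : WithTop ℕ∞} : ContDiff ℝ n (fun x : F => 1 + ‖x‖ ^ 2 / 2) := contDiff_const.add ((contDiff_norm_sq ℝ).div_const 2)

/-- `Dⁱq = ½·Dⁱ(‖·‖²)` for `i ≥ 1`. [folklore] -/
theorem iteratedFDeriv_quad_eq {i : ℕ} (hi : i ≠ 0) (x : F) :
    iteratedFDeriv ℝ i (fun x : F => 1 + ‖x‖ ^ 2 / 2) x = (2⁻¹ : ℝ) • iteratedFDeriv ℝ i (fun x : F => ‖x‖ ^ 2) x := by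
  have hfun : (fun x : F => 1 + ‖x‖ ^ 2 / 2) = (fun _ : F => (1 : ℝ)) + fun x : F => (2⁻¹ : ℝ) • ‖x‖ ^ 2 := by
    funext x
    simp only [Pi.add_apply, smul_eq_mul]
    ring
  rw [hfun, iteratedFDeriv_add_apply contDiff_const.contDiffAt ((contDiff_norm_sq ℝ).const_smul (2⁻¹ : ℝ)).contDiffAt, iteratedFDeriv_const_of_ne hi, Pi.zero_apply,
    zero_add, iteratedFDeriv_const_smul_apply' (contDiff_norm_sq ℝ).contDiffAt]

/-- **`‖Dⁱ q(x)‖ ≤ 1·q(x)` for `i ≥ 1`** (`½·2‖x‖ = ‖x‖ ≤ 1 + ½‖x‖²`, `½·2 = 1 ≤ q`, `0 ≤ q`): `q` is a symbol with `K = 1` in the sense of ★ (E-a). [cite: HormanderALPDO1, §7.1] -/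
theorem norm_iteratedFDeriv_quad_le {i : ℕ} (hi : 1 ≤ i) (x : F) : ‖iteratedFDeriv ℝ i (fun x : F => 1 + ‖x‖ ^ 2 / 2) x‖ ≤ 1 * (1 + ‖x‖ ^ 2 / 2) := by
  rw [iteratedFDeriv_quad_eq (by omega) x, norm_smul, norm_inv, Real.norm_two, one_mul]
  rcases Nat.lt_or_ge i 3 with hlt | hge
  · interval_cases i
    · calc 2⁻¹ * ‖iteratedFDeriv ℝ 1 (fun x : F => ‖x‖ ^ 2) x‖ ≤ 2⁻¹ * (2 * ‖x‖) := mul_le_mul_of_nonneg_left (norm_iteratedFDeriv_one_norm_sq_le x) (by norm_num)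
        _ = ‖x‖ := by ring
        _ ≤ 1 + ‖x‖ ^ 2 / 2 := by nlinarith [sq_nonneg (‖x‖ - 1)]
    · calc 2⁻¹ * ‖iteratedFDeriv ℝ 2 (fun x : F => ‖x‖ ^ 2) x‖ ≤ 2⁻¹ * 2 := mul_le_mul_of_nonneg_left (norm_iteratedFDeriv_two_norm_sq_le x) (by norm_num)
        _ = 1 := by norm_num
        _ ≤ 1 + ‖x‖ ^ 2 / 2 := one_le_quad x
  · rw [iteratedFDeriv_norm_sq_eq_zero_of_three_le hge, norm_zero, mul_zero]
    exact (quad_pos x).le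

end Quad

/-! ## §3 Complex powers of the symbol, UNIFORMLY on `‖w‖ ≤ R` -/

section Pow

/-- `x ↦ q(x)^{−w}` is smooth (★ (E-a) `contDiffOn_ofReal_cpow` on `u > 0`, composed with `q > 0`). [cite: HormanderALPDO1, §7.1] -/
theorem contDiff_quad_cpow_neg (w : ℂ) {n : WithTop ℕ∞} : ContDiff ℝ n (fun x : F => (((1 + ‖x‖ ^ 2 / 2 : ℝ)) : ℂ) ^ (-w)) :=
  (contDiffOn_ofReal_cpow (-w)).comp_contDiff contDiff_quad fun x => quad_pos x

/-- **(E-b) — `∃ C ≥ 0, ∀ ‖w‖ ≤ R, ∀ x, ‖Dⁿ[q^{−w}](x)‖ ≤ C·q(x)^{−Re w}`**, `q = 1 + ½‖·‖²` on a real inner-product space: ★ (E-a) `norm_iteratedFDeriv_cpow_neg_le_of_symbol` with §2's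
`K = 1`; its constant `Σ_c ∏_{l<|c|}(‖w‖ + l)` is bounded by the same sum at `max R 0`, so ONE `C = C(n, R)` serves all `‖w‖ ≤ R`. [cite: HormanderALPDO1, §7.1] [cite: MoeglinWaldspurger1995, I.2.10–I.2.12] -/
theorem exists_norm_iteratedFDeriv_quad_cpow_neg_le_uniform (R : ℝ) (n : ℕ) :
    ∃ C : ℝ, 0 ≤ C ∧ ∀ w : ℂ, ‖w‖ ≤ R → ∀ x : F,
      ‖iteratedFDeriv ℝ n (fun x : F => (((1 + ‖x‖ ^ 2 / 2 : ℝ)) : ℂ) ^ (-w)) x‖ ≤ C * (1 + ‖x‖ ^ 2 / 2) ^ (-w.re) := by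
  refine ⟨∑ p : OrderedFinpartition n, (∏ l ∈ Finset.range p.length, (max R 0 + l)) * (1 : ℝ) ^ p.length,
    Finset.sum_nonneg fun p _ => mul_nonneg (Finset.prod_nonneg fun l _ => by positivity) (pow_nonneg zero_le_one _), fun w hw x => ?_⟩
  have h := norm_iteratedFDeriv_cpow_neg_le_of_symbol n w (K := 1) (contDiff_quad (F := F)) one_le_quad (x := x) fun i hi _ => norm_iteratedFDeriv_quad_le hi x
  refine h.trans (mul_le_mul_of_nonneg_right (Finset.sum_le_sum fun p _ => mul_le_mul_of_nonneg_right
    (Finset.prod_le_prod (fun l _ => by positivity) fun l _ => by linarith [le_max_left R 0, le_max_right R 0, hw]) (pow_nonneg zero_le_one _))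
    (Real.rpow_nonneg (quad_pos x).le _))

/-- `(2z − 1).re = 2·Re z − 1` (plumbing). [folklore] -/
theorem two_mul_sub_one_re (z : ℂ) : (2 * z - 1).re = 2 * z.re - 1 := by
  simp [Complex.mul_re]

/-- `‖2z − 1‖ ≤ 2R + 1` for `‖z‖ ≤ R` (plumbing). [folklore] -/
theorem norm_two_mul_sub_one_le {z : ℂ} {R : ℝ} (hz : ‖z‖ ≤ R) : ‖2 * z - 1‖ ≤ 2 * R + 1 := by
  calc ‖2 * z - 1‖ ≤ ‖2 * z‖ + ‖(1 : ℂ)‖ := norm_sub_le _ _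
    _ = 2 * ‖z‖ + 1 := by rw [norm_mul, Complex.norm_two, norm_one]
    _ ≤ 2 * R + 1 := by linarith

/-- `x ↦ q(x)^{1−2z}` is smooth. [cite: HormanderALPDO1, §7.1] -/
theorem contDiff_quad_cpow_one_sub_two_mul (z : ℂ) {n : WithTop ℕ∞} : ContDiff ℝ n (fun x : F => (((1 + ‖x‖ ^ 2 / 2 : ℝ)) : ℂ) ^ (1 - 2 * z)) := by
  have h := contDiff_quad_cpow_neg (F := F) (2 * z - 1) (n := n)
  simp only [neg_sub] at h
  exact h

/-- **(E-b), THE `1 − 2z` EDITION — `∃ C ≥ 0, ∀ ‖z‖ ≤ R, ∀ x, ‖Dⁿ[q^{1−2z}](x)‖ ≤ C·q(x)^{1−2Re z}`** (`w = 2z − 1`, `‖w‖ ≤ 2R + 1`): the exponent of the scaled centre average of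
★ (E-c) `K2E1CentreAverageScalingU3`. [cite: HormanderALPDO1, §7.1] [cite: MoeglinWaldspurger1995, I.2.10–I.2.12] -/
theorem exists_norm_iteratedFDeriv_quad_cpow_one_sub_two_mul_le_uniform (R : ℝ) (n : ℕ) :
    ∃ C : ℝ, 0 ≤ C ∧ ∀ z : ℂ, ‖z‖ ≤ R → ∀ x : F,
      ‖iteratedFDeriv ℝ n (fun x : F => (((1 + ‖x‖ ^ 2 / 2 : ℝ)) : ℂ) ^ (1 - 2 * z)) x‖ ≤ C * (1 + ‖x‖ ^ 2 / 2) ^ (1 - 2 * z.re) := by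
  obtain ⟨C, hC0, hC⟩ := exists_norm_iteratedFDeriv_quad_cpow_neg_le_uniform (F := F) (2 * R + 1) n
  refine ⟨C, hC0, fun z hz x => ?_⟩
  have h := hC (2 * z - 1) (norm_two_mul_sub_one_le hz) x
  have hfun : (fun x : F => (((1 + ‖x‖ ^ 2 / 2 : ℝ)) : ℂ) ^ (1 - 2 * z)) = fun x : F => (((1 + ‖x‖ ^ 2 / 2 : ℝ)) : ℂ) ^ (-(2 * z - 1)) := by
    funext x
    rw [neg_sub]
  have hre : -(2 * z - 1).re = 1 - 2 * z.re := by rw [two_mul_sub_one_re]; ring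
  rw [hfun, ← hre]
  exact h

end Pow

end Summit.HodgeConjecture.HodgeConjecture.Cruxes.H413.K2E1QuadraticNormPowSymbol

end
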